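import Summits.BirchSwinnertonDyer.BirchSwinnertonDyer.Theses.PAdicOrderV2
import Literature.NumberTheory.EllipticCurves.PAdicLFunctionNeZeroHoldsProofs
import Literature.Barriers.BirchSwinnertonDyer.PAdicFunctionalEquationParity
import Summits.BirchSwinnertonDyer.BirchSwinnertonDyer.Theorems.PAdicOrderV2PAdicOrderRankOneR4OneLeOrder
import Summits.BirchSwinnertonDyer.BirchSwinnertonDyer.Theorems.PAdicOrderV2PAdicOrderRankOneR4MixedCoeff

/-!
# Line `Sketch` (= idea `tame-shadow-derived-kato`) for crux `PAdicOrderV2.PAdicOrderRankOneR4` (stmt-BirchSwinnertonDyer-0515)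

Skeleton (line lead `prover-line-stmt-BirchSwinnertonDyer-0515-0`, 2026-08-16), rebuilt from the crux idea card
`Cruxes/PAdicOrderRankOneR4/Ideas/tame-shadow-derived-kato.md` (ideator k1, round 1; the ideator's `Sketch.lean`
evidence file is not readable from the lead's jail, so the algebraic core is re-derived here as `stub_mixedCoeff`).
Routes wanting the crux: `route-BirchSwinnertonDyer-PAdicOrder`, `route-BirchSwinnertonDyer-PAdicOrderV2` (same
statement); this file concludes the V2 decl BY NAME (`PAdicOrderRankOneR4_of`, `PAdicOrderRankOneR4_proof`).

## The crux (recall)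

`PAdicOrderRankOneR4`: for `W/ℚ` elliptic and globally minimal, `p` good ordinary (`IsOrdinaryAt W p`),
`W.analyticRank = 1`, and `f ∈ S₂(Γ₀(N))` the newform of `W` (`IsNewformOf W f`):
`(padicLFunction f (unitRoot W p)).order = 1` — the `T`-order of the Mazur–Swinnerton-Dyer `p`-adic `L`-function
`L_p(E,T) = L_p(f, α_p, T)` is exactly one (rank-one "p-adic order = complex order"; `≤ 1` is rank-one Schneider).

## The line (lever: Λ-adic duality between the Kolyvagin derivative of Kato's zeta element and its involute)

    PAdicOrderRankOneR4  ⇐  (1 ≤ ord_T L_p)  ∧  ¬ (2 ≤ ord_T L_p)            [`_of`: `ℕ∞` arithmetic]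
      1 ≤ ord_T L_p      = stub_one_le_order                                  [interpolation `L_p(0) = (1-α⁻¹)²[0]⁺`,
                                                                               `[0]⁺Ω⁺ = L(E,1) = 0`: tree THEOREMS]
      ¬ (2 ≤ ord_T L_p)  ⇐  stub_shadowIdentity (K1) + stub_mixedCoeff (P1) + stub_shadowNonconstancy (K2)
                            on the MAIN RANGE `5 ≤ p`, `a_p ≢ 1 (mod p)`, `ρ̄_{E,p}` surjective (v2; v1 had `E[p]` irreducible);
                         ⇐  stub_residual (K3) off the main range (p ∈ {2,3}, anomalous p, ρ̄_{E,p} not surjective — incl. CM).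

* K1 `stub_shadowIdentity` — what the Euler-system argument must deliver, stated over tree vocabulary only: if
  `2 ≤ ord_T L_p` then there are constants `c₀ d₀ c₁` such that for every precision `m`, with `M = m + c₀`, there are
  `ℓ`-INDEPENDENT series `u, w ∈ (ℤ/p^m)⟦X⟧` with `u(0)w(0) ∉ (p^{c₁})` such that for every Kolyvagin prime `ℓ` of
  modulus `p^{M+1}`, every discrete logarithm `ψ : (ℤ/ℓ)ˣ ↠ ℤ/p^M` and the reductions `b₀, b₁ mod p^m` of
  `p^d · B_j(ℓ)` (`j = 0, 1`; `B_j = tameMixedCoeff`, the `T^j(σ_ℓ - 1)`-coefficient of the two-variable Mazur–Tate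
  element `θ_{f, ℓ p^{M+e₀}}`, a finite sum of rational plus symbols weighted by `ψ` and by the cyclotomic coordinate)
  one has `c·t·t^ι + u·b·w^ι + ι²·R = X²·S` for some `t, R, S`, `c`, and some `b` with `b(0) = b₀`, `b'(0) = b₁`
  (`ι = invOnePlusSubOne = (1+X)⁻¹ - 1`). Source shape: Kato's explicit reciprocity law at tame level (Kato 2004
  §16–17; Kurihara 2002; Kataoka 2021), Coleman / big-logarithm dévissage at a non-anomalous ordinary `p`
  (Perrin-Riou 1994; Rubin, Euler Systems, App.), finite–singular comparison (Rubin Thm 4.5.4; Mazur–Rubin 2004),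
  finite-level Poitou–Tate, and `w(0) ≠ 0` = Perrin-Riou's conjecture in analytic rank one (Bertolini–Darmon–Venerucci
  2022; Burns–Kurihara–Sano arXiv:1910.07404 Thm 1.4/1.8). NOT in the tree; research-level (card: crux-sized).
* P1 `stub_mixedCoeff` — the `X¹`-coefficient of that identity: `u₀w₀·b₁ = b₀·(u₀w₁ - u₁w₀)` (pure algebra).
* K2 `stub_shadowNonconstancy` — horizontal non-constancy: for all constants, at some precision `m`, no projective
  vector `(V₀ : V₁)` with `V₀ ∉ (p^{c₁})` is proportional to `(b₀(ℓ) : b₁(ℓ))` for ALL Kolyvagin `ℓ` (two primes with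
  different wild×tame ratios). By the card's own account presumably EQUIVALENT to the crux; research-level.
* K3 `stub_residual` — the crux itself off the main range (no mechanism offered by the line there).
* S1 `stub_one_le_order` — provable now from tree theorems (interpolation is DISCHARGED in the tree:
  `constantCoeff_padicLFunction_unitRoot`, `IsNewformOf.entireLFunction_one_eq`, `IsNewform0.plusPeriod_pos_holds`).

## Lead status (v2, 2026-08-16, after wave 1)

CLOSED (landed, imported above, `sorry` replaced by the Theorems decl): S1 `stub_one_le_order` — p97073
`Theorems/PAdicOrderV2PAdicOrderRankOneR4OneLeOrder.lean`; P1 `stub_mixedCoeff` — p96992 `…MixedCoeff.lean`.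
RESHAPED (wave-1 worker on K1, `stub-misstated`, findings file `work/stubs/stub_shadowIdentity.lean`): (i) v1 quantified
K1 over ALL precisions `m`, and at `m ≤ c₁` (e.g. `m = 0`, ring `ℤ/1`) the conjunct `u(0)w(0) ∉ (p^{c₁})` is unsatisfiable, so
v1-K1 was provably EQUIVALENT to the main-range crux and v1-K2 was inhabited by `m := 0` — degenerate split; v2 restricts K1 to
`c₁ < m` and makes K2 produce `m > c₁`; (ii) the conductor-`ℓ` Coleman map needs the ℓ-LEVEL non-anomaly `a_p^{ord_ℓ p} ≢ 1 (mod p)`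
(Kataoka 2021 Ass. 3.7 / Prop. 3.9) for an ℓ-uniform `c₀`: added as `IsEllNonanomalous` on the Kolyvagin prime (K2 must produce
such ℓ; positive density); (iii) every printed integral input assumes `ρ_{E,p}` onto / `⊇ SL₂(ℤ_p)`, and without an order-`p`
element in `ρ̄(G_ℚ)` there is NO Kolyvagin prime (K2 false: all CM curves): main range now `ρ̄_{E,p}` surjective
(`W.HasSurjectiveModNGaloisRep p`), its complement (incl. the KNOWN CM case, Bertrand 1982 + Perrin-Riou 1987 Cor. 1.9, as quoted by
Rubin, Durham 1989 Thm 1.2(ii)) goes to K3. Card falsifier (a) does NOT fire (Kato Ast. 295 Prop. 17.11 / Lemma 17.12: Col has finite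
cokernel, trivial iff `a_p ≢ 1`; finite index ⟹ image ⊄ T·Λ). Wave-1 worker on K3: no junk lever at p = 2, 3 or anomalous p
(`unitRoot` honest by Hensel for every ordinary p; every ordinary p = 2 is anomalous); residual range = honest open cases + the citable CM case.
OPEN: K1 `stub_shadowIdentity` (research; typed specs F1–F5 in the findings file), K2 `stub_shadowNonconstancy` (lead; research,
≈ crux), K3 `stub_residual` (crux off the main range).

## LINE DEAD (lead, 2026-08-16, end of cycle 1) — see `Cruxes/PAdicOrderRankOneR4/Lines/Sketch-dead.md`

K2 `stub_shadowNonconstancy` is FALSE on every instance of its hypotheses and K1 is vacuous: by the Fricke functional equation of the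
plus symbols (`IsFrickeEigen.normalizedPlusSymbol_div_eq_mul`, sign `w_E = -1` in analytic rank one) together with the exact Euler-factor
identities `Θ₀ = (a_ℓ-2)S₀ = 0`, `C₁ = (a_ℓ-2)S₁`, one has `2·b₁ + s̃(N)·b₀ = 0` in `ZMod (p^m)` at EVERY Kolyvagin prime (`s̃(N)` = cyclotomic
coordinate of the conductor), so `(b₀ : b₁)` is frozen at `(2 : -s̃(N))` whatever `ord_T L_p` is. Confirmed numerically for 37a1, p = 5
(10/10 Kolyvagin primes mod 25 at one digit, 2/2 Kolyvagin primes mod 125 at two digits). S1 and P1 stay landed; this file is kept as the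
registered record of the line.

## Disproof used

None available at registration (no `Cruxes/PAdicOrderRankOneR4/Disproof.lean`; `ledger negatives --problem
BirchSwinnertonDyer` = 0 per the card). `L_p ≠ 0` (needed nowhere below, but it makes `order` finite) is the tree
theorem `padicLFunction_unitRoot_ne_zero`.
-/

set_option linter.unusedVariables false
set_option linter.dupNamespace false
set_option linter.unreachableTactic false
set_option linter.unusedTactic false

noncomputable section

namespace Summit.BirchSwinnertonDyer.BirchSwinnertonDyer.Cruxes.PAdicOrderRankOneR4.TameShadow


open CongruenceSubgroup PowerSeries
open Summit.BirchSwinnertonDyer.BirchSwinnertonDyer.Theses.PAdicOrderV2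
open Literature.NumberTheory.EllipticCurves Literature.NumberTheory.EllipticCurves.ModularForms
open Literature.Barriers.BirchSwinnertonDyer

/-! ## Line vocabulary (local copies; to move to `Theorems/PAdicOrderV2TameShadowDefs.lean`) -/

/-- The **tame Mazur–Swinnerton-Dyer measure** of `(f, α)` at tame level `L` and `p`-level `m`: for
`a mod L·p^m`, `μ^{(L)}_{f,α}(a) = α^{-m} [a/(L p^m)]⁺_f - α^{-(m+1)} [a/(L p^{m-1})]⁺_f` (Mazur–Tate–Teitelbaum 1986
§I.10 (10.1) with tame conductor `L`; at `L = 1`, `m = n + 1` this is the tree's `msdMeasure f α (n+1)`; at `m = 0` the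
`ℕ`-subtraction gives `(1 - α⁻¹)[a/L]⁺`, the `p`-stabilised level-`L` value). These are the coefficients of the
two-variable Mazur–Tate element `θ_{f, L p^m} = ∑_a μ^{(L)}(a) σ_a`. [cite: MazurTateTeitelbaum1986Invent, §I.10 (10.1)] -/
def tameMsdMeasure {N : ℕ} (f : CuspForm (Gamma0 N) 2) {p : ℕ} [Fact p.Prime] (α : ℚ_[p]) (L m : ℕ)
    (a : ZMod (L * p ^ m)) : ℚ_[p] :=
  α⁻¹ ^ m * (ratPlusSymbol f ((a.val : ℚ) / ((L : ℚ) * (p : ℚ) ^ m)) : ℚ_[p]) -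
    α⁻¹ ^ (m + 1) * (ratPlusSymbol f ((a.val : ℚ) / ((L : ℚ) * (p : ℚ) ^ (m - 1))) : ℚ_[p])

/-- The residue `a mod L·p^m` with prescribed components `b mod L` and `c mod p^m` (Chinese remainder theorem; junk `0`
when `L` and `p^m` are not coprime, a case never used: `L = ℓ ≠ p` prime). [folklore] -/
def crtResidue (L : ℕ) {p : ℕ} (m : ℕ) (b : ZMod L) (c : ZMod (p ^ m)) : ZMod (L * p ^ m) :=
  if h : Nat.Coprime L (p ^ m) then (ZMod.chineseRemainder h).symm (b, c) else 0

/-- The **mixed (wild × tame) coefficient** `B_j(ℓ)` (`j = 0, 1, …`) of the two-variable Mazur–Tate element of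
`(f, α)` at tame prime `ℓ` and cyclotomic level `n` (conductor `p^{n+e₀}`), read through a discrete logarithm
`ψ : (ℤ/ℓ)ˣ → ℤ/p^M` and the tree's cyclotomic coordinate `a = η·γ^s`, `γ = cyclotomicGenerator p`, `s ∈ [0, p^n)`:
`B_j = ∑_{η} ∑_{s mod p^n} ∑ᶠ_{b ∈ (ℤ/ℓ)ˣ} μ^{(ℓ)}_{n+e₀}(b, η γ^s) · ψ(b) · (s choose j)`, with `ψ(b)` lifted to
`[0, p^M)`. For `j = 0, 1` these are the `T⁰`- and `T¹`-coefficients (`(1+T)^s = ∑_j (s choose j) T^j`, as in the tree's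
`padicLRiemannSum`) of the `(σ_ℓ - 1)`-coefficient (first Kolyvagin–Darmon derivative: `σ_ℓ^{ψ(b)} = 1 + ψ(b)(σ_ℓ - 1) + …`)
of `θ_{f, ℓ p^{n+e₀}}` projected to `ℤ_p[ℤ/p^M × Γ_n]`; both readings are only meaningful modulo `p^{min(M,n)}` and after
clearing the bounded denominators of the plus symbols, which is how the stubs use them. (Card `tame-shadow-derived-kato`,
D1; Mazur–Tate 1987 / Kurihara 2002 for `θ`-elements and their derivatives.) [cite: MazurTateTeitelbaum1986Invent, §I.10 and §I.13] -/
def tameMixedCoeff {N : ℕ} (f : CuspForm (Gamma0 N) 2) {p : ℕ} [Fact p.Prime] (α : ℚ_[p]) (ℓ M : ℕ)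
    (ψ : (ZMod ℓ)ˣ →* Multiplicative (ZMod (p ^ M))) (n j : ℕ) : ℚ_[p] :=
  ∑ᶠ η : rootsOfUnity (torsionOrder p) ℤ_[p], ∑ s : ZMod (p ^ n), ∑ᶠ b : (ZMod ℓ)ˣ,
    tameMsdMeasure f α ℓ (n + cyclotomicExponent p)
        (crtResidue ℓ (n + cyclotomicExponent p) (b : ZMod ℓ)
          (PadicInt.toZModPow (n + cyclotomicExponent p) ((η : ℤ_[p]ˣ) : ℤ_[p]) *
            (cyclotomicGenerator p : ZMod (p ^ (n + cyclotomicExponent p))) ^ s.val)) *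
      ((Multiplicative.toAdd (ψ b)).val : ℚ_[p]) * (s.val.choose j : ℚ_[p])

/-- **Kolyvagin primes for `E[p^n]` over `ℚ`** (Kato / Mazur–Rubin side conditions, elementary form): `ℓ` is a prime
`≠ p` of good reduction with `ℓ ≡ 1 (mod p^n)`, `a_ℓ ≡ ℓ + 1 (mod p^n)` (so `p^n ∣ #Ẽ(𝔽_ℓ)` and `Frob_ℓ` has both
eigenvalues `≡ 1`), and the `p`-torsion of `Ẽ(𝔽_ℓ)` has order exactly `p` (so `Ẽ(𝔽_ℓ)[p^∞]` is CYCLIC of order `≥ p^n`,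
i.e. `E[p^n]/(Frob_ℓ - 1)` is free of rank one over `ℤ/p^n` — the transvection condition of Mazur–Rubin, Mem. AMS 799,
Def. 3.1.6 / Rubin, Euler Systems, §4). [cite: RubinEulerSystems2000, §4.1 (Kolyvagin primes)] -/
def IsKolyvaginPrime (W : WeierstrassCurve ℚ) [W.IsGloballyMinimal] (p n ℓ : ℕ) : Prop :=
  ∃ _ : Fact ℓ.Prime, ℓ ≠ p ∧ W.HasGoodReductionAtPrime ℓ ∧ (p ^ n : ℤ) ∣ (ℓ : ℤ) - 1 ∧
    (p ^ n : ℤ) ∣ W.frobeniusTrace ℓ - (ℓ + 1) ∧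
    Nat.card {P : ((WeierstrassCurve.integralModelInt W).map (Int.castRingHom (ZMod ℓ))).toAffine.Point //
      p • P = 0} = p

/-- **ℓ-level non-anomaly** (Kataoka, Math. Z. 298 (2021) = arXiv:2008.02422, Assumption 3.7 with Prop. 3.9: for the
conductor-`ℓ` cyclotomic tower the equivariant Coleman map at an ordinary `p` needs `Ẽ(𝔽_{p^h})[p] = 0`, `h` = residue degree of
`ℚ(μ_ℓ)` at `p` = multiplicative order of `p mod ℓ`, i.e. `a_p^h ≢ 1 (mod p)`). Elementary spelling: `p ∤ a_p(W)^{ord_ℓ(p)} - 1`;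
at `h = 1` it is the usual `a_p ≢ 1 (mod p)`. [cite: Kataoka2021MathZ, Assumption 3.7 and Prop. 3.9] -/
def IsEllNonanomalous (W : WeierstrassCurve ℚ) [W.IsGloballyMinimal] (p ℓ : ℕ) : Prop :=
  ¬ (p : ℤ) ∣ W.frobeniusTrace p ^ orderOf (p : ZMod ℓ) - 1

/-- `x mod p^m` **is the reduction of** the `p`-adic number `y`: `y` is a `p`-adic integer whose image in `ℤ/p^m` is
`x` (so the relation is empty for non-integral `y` and functional otherwise). [folklore] -/
def IsZModReduction {p : ℕ} [Fact p.Prime] (m : ℕ) (x : ZMod (p ^ m)) (y : ℚ_[p]) : Prop :=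
  ∃ z : ℤ_[p], (z : ℚ_[p]) = y ∧ PadicInt.toZModPow m z = x

/-! ## The five stubs (S1, P1 landed; K1, K2, K3 registered, open) -/

/-- **S1 · `stub_one_le_order` — the `≥ 1` half (interpolation).** LANDED p97073 (`Theorems.TameShadow.stub_one_le_order`). At a good ordinary `p`, for the newform `f` of a
globally minimal elliptic `W` of analytic rank one, `L_p(E, 0) = 0`, i.e. `1 ≤ ord_T L_p(E,T)`:
`L_p(E,0) = (1 - α⁻¹)² [0]⁺_f` (`constantCoeff_padicLFunction_unitRoot`, DISCHARGED in the tree), `[0]⁺_f · Ω⁺_f = L(E,1)`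
(`IsNewformOf.entireLFunction_one_eq`, `IsNewform0.plusPeriod_pos_holds`) and `L(E,1) = 0` because
`analyticRank = analyticOrderNatAt L(E,·) 1 = 1 ≠ 0`. Mazur–Tate–Teitelbaum 1986 §I.14; provable now.
[cite: MazurTateTeitelbaum1986Invent, §I.14 (14.3)] -/
theorem stub_one_le_order :
    ∀ (W : WeierstrassCurve ℚ) [W.IsElliptic] [W.IsGloballyMinimal] (p : ℕ) [Fact p.Prime],
      IsOrdinaryAt W p → W.analyticRank = 1 →
      ∀ {N : ℕ} [NeZero N] (f : CuspForm (Gamma0 N) 2), IsNewformOf W f →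
        (1 : ℕ∞) ≤ (padicLFunction f (unitRoot W p : ℚ_[p])).order :=
  Summit.BirchSwinnertonDyer.BirchSwinnertonDyer.Theorems.TameShadow.stub_one_le_order

/-- **P1 · `stub_mixedCoeff` — the `X¹`-coefficient of the duality identity (algebraic core of the card).** LANDED p96992 (`Theorems.TameShadow.stub_mixedCoeff`). Over any
commutative ring, if `c·t·t(ι) + u·b·w(ι) + ι²·R = X²·S` with `ι = invOnePlusSubOne = -X + X² - …`, then
`u₀ w₀ b₁ = b₀ (u₀ w₁ - u₁ w₀)`: the `X¹`-coefficient of `t·t(ι)` vanishes by symmetry (`t(ι) = t₀ - t₁X + …`), those of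
`ι²R` and `X²S` vanish by order, and that of `u·b·w(ι)` is `-u₀b₀w₁ + (u₀b₁ + u₁b₀)w₀`. [folklore] -/
theorem stub_mixedCoeff :
    ∀ {R : Type} [CommRing R] (c : R) (t u b w Rs S : R⟦X⟧),
      C c * t * t.subst invOnePlusSubOne + u * b * w.subst invOnePlusSubOne + invOnePlusSubOne ^ 2 * Rs
          = X ^ 2 * S →
      constantCoeff u * constantCoeff w * coeff 1 b =
        constantCoeff b * (constantCoeff u * coeff 1 w - coeff 1 u * constantCoeff w) :=
  Summit.BirchSwinnertonDyer.BirchSwinnertonDyer.Theorems.TameShadow.stub_mixedCoeff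

/-- **K1 · `stub_shadowIdentity` — the Λ-adic duality identity modulo `(X², p^m)` at every Kolyvagin prime, under
`2 ≤ ord_T L_p` (the card's K1, output form; v2).** Main range only: `5 ≤ p`, `p` good ordinary and non-anomalous
(`a_p ≢ 1 mod p`), `ρ̄_{E,p}` surjective, analytic rank one. Conclusion: constants `c₀` (loss of precision: index of Kato's
Coleman map, `v_p(λ log_ω P)`, torsion exponents), `d₀` (denominators of the plus symbols) and `c₁` (valuation of
`u(0)w(0)`) such that for all `d ≥ d₀` and every precision `m > c₁` (`M = m + c₀`) there are ℓ-INDEPENDENT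
`u w ∈ (ℤ/p^m)⟦X⟧`, `u(0)w(0) ∉ (p^{c₁})`, for which at every ℓ-non-anomalous Kolyvagin prime `ℓ` of modulus `p^{M+1}`,
for every surjective `ψ : (ℤ/ℓ)ˣ → ℤ/p^M` and for THE reductions `b₀, b₁ mod p^m` of `p^d B₀(ℓ), p^d B₁(ℓ)`
(`B_j = tameMixedCoeff f α ℓ M ψ M j`) the identity `c·t·t(ι) + u·b·w(ι) + ι²·R = X²·S` holds for some `t R S c` and some
`b` with `b(0) = b₀`, `b'(0) = b₁`. Printed ingredients: Kato 2004 (Astérisque 295) Thm 16.6/§17 (explicit reciprocity,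
`Col(loc_p z) = L_p`, tame level: Kurihara, Invent. 149 (2002); Kataoka, Math. Z. 298 (2021)); Perrin-Riou, Invent. 115
(1994) and Rubin, *Euler Systems* (2000) Thm 4.5.4 + App. (Coleman map / big logarithm, finite–singular comparison);
Mazur–Rubin, Mem. AMS 799 (2004); Bertolini–Darmon–Venerucci, Adv. Math. 398 (2022) and Burns–Kurihara–Sano
arXiv:1910.07404 Thm 1.4/1.8 (`w(0) ∝ log_ω z_{Kato,0} ≠ 0` in analytic rank one). None of it is in the tree:
research-level stub (card: crux K1, rank 2). [cite: Kato2004Asterisque, Thm. 16.6 and §17] -/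
theorem stub_shadowIdentity :
    ∀ (W : WeierstrassCurve ℚ) [W.IsElliptic] [W.IsGloballyMinimal] (p : ℕ) [Fact p.Prime],
      5 ≤ p → IsOrdinaryAt W p → ¬ (p : ℤ) ∣ W.frobeniusTrace p - 1 → W.HasSurjectiveModNGaloisRep (p : ℤ) →
      W.analyticRank = 1 →
      ∀ {N : ℕ} [NeZero N] (f : CuspForm (Gamma0 N) 2), IsNewformOf W f →
      (2 : ℕ∞) ≤ (padicLFunction f (unitRoot W p : ℚ_[p])).order →
      ∃ c₀ d₀ c₁ : ℕ, ∀ d : ℕ, d₀ ≤ d → ∀ m : ℕ, c₁ < m →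
        ∃ u w : (ZMod (p ^ m))⟦X⟧,
          ¬ ((p : ZMod (p ^ m)) ^ c₁ ∣ constantCoeff u * constantCoeff w) ∧
          ∀ ℓ : ℕ, IsKolyvaginPrime W p (m + c₀ + 1) ℓ → IsEllNonanomalous W p ℓ →
          ∀ ψ : (ZMod ℓ)ˣ →* Multiplicative (ZMod (p ^ (m + c₀))), Function.Surjective ψ →
          ∀ b₀ b₁ : ZMod (p ^ m),
            IsZModReduction m b₀ ((p : ℚ_[p]) ^ d * tameMixedCoeff f (unitRoot W p : ℚ_[p]) ℓ (m + c₀) ψ (m + c₀) 0) →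
            IsZModReduction m b₁ ((p : ℚ_[p]) ^ d * tameMixedCoeff f (unitRoot W p : ℚ_[p]) ℓ (m + c₀) ψ (m + c₀) 1) →
            ∃ (b t Rs S : (ZMod (p ^ m))⟦X⟧) (c : ZMod (p ^ m)),
              constantCoeff b = b₀ ∧ coeff 1 b = b₁ ∧
              C c * t * t.subst invOnePlusSubOne + u * b * w.subst invOnePlusSubOne +
                  invOnePlusSubOne ^ 2 * Rs = X ^ 2 * S := by
  sorry

/-- **K2 · `stub_shadowNonconstancy` — horizontal non-constancy of the wild×tame ratio (the card's K2, the decisive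
stub; v2).** Same main range, analytic rank one, NO hypothesis on `ord_T L_p`: for all constants `c₀ d₀ c₁` there are
`d ≥ d₀` and a precision `m > c₁` such that no `(V₀, V₁)`, `V₀ ∉ (p^{c₁})`, satisfies `V₀·b₁(ℓ) = b₀(ℓ)·V₁` for every
ℓ-non-anomalous Kolyvagin prime `ℓ` of modulus `p^{m+c₀+1}`, every surjective `ψ` and the reductions `b_j(ℓ)` of
`p^d B_j(ℓ)` — i.e. two such Kolyvagin primes with non-proportional `(b₀ : b₁)` (such ℓ have positive density by Chebotarev
once `ρ̄_{E,p}` is surjective; with no order-`p` element in `ρ̄(G_ℚ)` there is none and the statement would be false). Horizontal tools named by the card: Chebotarev choice of Kolyvagin primes,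
Kolyvagin-system rigidity (Mazur–Rubin 2004; Büyükboduk 2011), horizontal `p`-adic `L`-functions / non-vanishing mod
`p^M` of twisted modular symbols (Kriz–Nordentoft arXiv:2310.20678 §1; Washington 1978; Sinnott 1984; Vatsal 2003;
Burungale–Sun 2020). Presumably EQUIVALENT to the crux (card); research-level. [cite: MazurRubin2004, §3 (Kolyvagin systems, rigidity)] -/
theorem stub_shadowNonconstancy :
    ∀ (W : WeierstrassCurve ℚ) [W.IsElliptic] [W.IsGloballyMinimal] (p : ℕ) [Fact p.Prime],
      5 ≤ p → IsOrdinaryAt W p → ¬ (p : ℤ) ∣ W.frobeniusTrace p - 1 → W.HasSurjectiveModNGaloisRep (p : ℤ) →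
      W.analyticRank = 1 →
      ∀ {N : ℕ} [NeZero N] (f : CuspForm (Gamma0 N) 2), IsNewformOf W f →
      ∀ c₀ d₀ c₁ : ℕ, ∃ d : ℕ, d₀ ≤ d ∧ ∃ m : ℕ, c₁ < m ∧
        ∀ V₀ V₁ : ZMod (p ^ m), ¬ ((p : ZMod (p ^ m)) ^ c₁ ∣ V₀) →
          ∃ ℓ : ℕ, IsKolyvaginPrime W p (m + c₀ + 1) ℓ ∧ IsEllNonanomalous W p ℓ ∧
          ∃ ψ : (ZMod ℓ)ˣ →* Multiplicative (ZMod (p ^ (m + c₀))), Function.Surjective ψ ∧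
          ∃ b₀ b₁ : ZMod (p ^ m),
            IsZModReduction m b₀ ((p : ℚ_[p]) ^ d * tameMixedCoeff f (unitRoot W p : ℚ_[p]) ℓ (m + c₀) ψ (m + c₀) 0) ∧
            IsZModReduction m b₁ ((p : ℚ_[p]) ^ d * tameMixedCoeff f (unitRoot W p : ℚ_[p]) ℓ (m + c₀) ψ (m + c₀) 1) ∧
            V₀ * b₁ ≠ b₀ * V₁ := by
  sorry

/-- **K3 · `stub_residual` — the crux off the main range** (`p ∈ {2, 3}`, anomalous `p`, or `ρ̄_{E,p}` not surjective — this
includes every CM curve): no mechanism of the line applies (Kato's integrality and the Coleman/big-logarithm isomorphisms need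
`p` odd, `a_p ≢ 1`, big image; without an order-`p` element in `ρ̄(G_ℚ)` there are no Kolyvagin primes); recorded as the card's
K3 (crux, rank 4). Wave-1 assessment: no junk lever anywhere on this range (`unitRoot` is honest by Hensel at every ordinary `p`;
every ordinary `p = 2` is anomalous); the CM sub-case (`p ≥ 5` ordinary = split) is the KNOWN case in print — Bertrand 1982
(non-vanishing of `p`-adic heights of non-torsion points on CM curves) + Perrin-Riou 1987 Cor. 1.9, as quoted by Rubin, LMS LN 153
(Durham 1989) Thm 1.2(ii): `ord_T L_p = 1` in analytic rank one — a Literature-fact candidate; `p = 2`, anomalous non-CM and the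
exceptional-image cases have nothing in print. The route pre-classifies `p ∈ {2,3}` refutations as misstated with repair `5 ≤ p →`.
[cite: PerrinRiou1987, Cor. 1.9] -/
theorem stub_residual :
    ∀ (W : WeierstrassCurve ℚ) [W.IsElliptic] [W.IsGloballyMinimal] (p : ℕ) [Fact p.Prime],
      IsOrdinaryAt W p → W.analyticRank = 1 →
      ¬ (5 ≤ p ∧ ¬ (p : ℤ) ∣ W.frobeniusTrace p - 1 ∧ W.HasSurjectiveModNGaloisRep (p : ℤ)) →
      ∀ {N : ℕ} [NeZero N] (f : CuspForm (Gamma0 N) 2), IsNewformOf W f →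
        (padicLFunction f (unitRoot W p : ℚ_[p])).order = 1 := by
  sorry

/-! ## Stub statements by name -/

namespace Statement

/-- Statement of `stub_shadowIdentity`. -/
abbrev stub_shadowIdentity : Prop := type_of% @TameShadow.stub_shadowIdentity
/-- Statement of `stub_shadowNonconstancy`. -/
abbrev stub_shadowNonconstancy : Prop := type_of% @TameShadow.stub_shadowNonconstancy
/-- Statement of `stub_residual`. -/
abbrev stub_residual : Prop := type_of% @TameShadow.stub_residual

end Statement

/-! ## The composition (sorry-free) -/

/-- `ℕ∞` bookkeeping: `1 ≤ e`, `¬ 2 ≤ e` give `e = 1`. [folklore] -/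
theorem enat_eq_one_of_one_le_of_not_two_le {e : ℕ∞} (h1 : (1 : ℕ∞) ≤ e) (h2 : ¬ (2 : ℕ∞) ≤ e) : e = 1 := by
  induction e using ENat.recTopCoe with
  | top => exact absurd le_top h2
  | coe n =>
    have h1' : 1 ≤ n := by exact_mod_cast h1
    have h2' : ¬ 2 ≤ n := fun h => h2 (by exact_mod_cast h)
    have : n = 1 := by omega
    subst this; rfl

/-- **Main range**: K1 + P1 (landed `Theorems.TameShadow.stub_mixedCoeff`) + K2 contradict `2 ≤ ord_T L_p`. -/
theorem not_two_le_order_of_shadow (hK1 : Statement.stub_shadowIdentity) (hK2 : Statement.stub_shadowNonconstancy)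
    (W : WeierstrassCurve ℚ) [W.IsElliptic] [W.IsGloballyMinimal] (p : ℕ) [Fact p.Prime]
    (hp : 5 ≤ p) (hord : IsOrdinaryAt W p) (hna : ¬ (p : ℤ) ∣ W.frobeniusTrace p - 1)
    (hsur : W.HasSurjectiveModNGaloisRep (p : ℤ)) (hr : W.analyticRank = 1)
    {N : ℕ} [NeZero N] (f : CuspForm (Gamma0 N) 2) (hf : IsNewformOf W f) :
    ¬ (2 : ℕ∞) ≤ (padicLFunction f (unitRoot W p : ℚ_[p])).order := by
  intro h2
  obtain ⟨c₀, d₀, c₁, hK1'⟩ := hK1 W p hp hord hna hsur hr f hf h2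
  obtain ⟨d, hd, m, hm, hK2'⟩ := hK2 W p hp hord hna hsur hr f hf c₀ d₀ c₁
  obtain ⟨u, w, huw, hid⟩ := hK1' d hd m hm
  obtain ⟨ℓ, hℓ, hℓna, ψ, hψ, b₀, b₁, hb₀, hb₁, hne⟩ :=
    hK2' (constantCoeff u * constantCoeff w) (constantCoeff u * coeff 1 w - coeff 1 u * constantCoeff w) huw
  obtain ⟨b, t, Rs, S, c, hb0, hb1, hident⟩ := hid ℓ hℓ hℓna ψ hψ b₀ b₁ hb₀ hb₁
  have key := stub_mixedCoeff c t u b w Rs S hident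
  rw [hb0, hb1] at key
  exact hne key

/-- **`PAdicOrderRankOneR4_of`** — the three OPEN stub STATEMENTS imply the crux, BY NAME, using the two LANDED stubs
(`stub_one_le_order` p97073, `stub_mixedCoeff` p96992) as theorems: `1 ≤ ord` (S1) and `¬ 2 ≤ ord` (K1 + P1 + K2 on the
main range) give `ord = 1`; off the main range K3 is the statement itself. -/
theorem PAdicOrderRankOneR4_of (h₃ : Statement.stub_shadowIdentity) (h₄ : Statement.stub_shadowNonconstancy)
    (h₅ : Statement.stub_residual) : PAdicOrderRankOneR4 := by
  intro W _ _ p _ hord hr N _ f hf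
  by_cases hmain : 5 ≤ p ∧ ¬ (p : ℤ) ∣ W.frobeniusTrace p - 1 ∧ W.HasSurjectiveModNGaloisRep (p : ℤ)
  · exact enat_eq_one_of_one_le_of_not_two_le (stub_one_le_order W p hord hr f hf)
      (not_two_le_order_of_shadow h₃ h₄ W p hmain.1 hord hmain.2.1 hmain.2.2 hr f hf)
  · exact h₅ W p hord hr hmain f hf

/-- The crux along this line, MODULO the three open registered stubs. -/
theorem PAdicOrderRankOneR4_proof : PAdicOrderRankOneR4 :=
  PAdicOrderRankOneR4_of stub_shadowIdentity stub_shadowNonconstancy stub_residual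

end Summit.BirchSwinnertonDyer.BirchSwinnertonDyer.Cruxes.PAdicOrderRankOneR4.TameShadow

end
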